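import Literature.Probability.RandomPlanarGeometry.HexSAWPathRigidity

/-!
# The direction of a walk turns by its winding: exit direction = `e^{iW}` · entrance direction

Helper file for the crux `NoFoldBound` (stmt-CriticalPhenomena-8296) of the route `SAWDevelopingMap`
(sub-problem `SAWScalingLimit` of `CriticalPhenomena`), programme FLAT / PEELED LP of the lead seats
c9–c10 (`FLAT-LEAN-DESIGN.md` on the item), brick L2(i). In an equality row of the peeled linear
programme — the Duminil-Copin–Smirnov identity of a door summed over the domain,
`Σ_{darts} (mid{y,w} − c(y)) · F_s({y,w}) = 0` (`Peel.sum_boundary_darts_observable_eq_zero`) — the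
dart coefficient `mid{y,w} − c(y) = (c(w) − c(y))/2` is the ENTRANCE coefficient of the door rotated
by the winding `W` of the walk: "the winding is the total rotation of the direction"
(Duminil-Copin–Smirnov 2012, §2). Dividing the row by the entrance coefficient therefore leaves the
pure phases `e^{iW} e^{-i(5/8)W} = e^{i(3/8)W}`, `(3/8)W ∈ 22.5°·ℤ`, which is what puts every
coefficient of the certificate in `ℚ(√(2+√2))` (`PeelCertField.lean`). This file proves the rotation
statement on the lattice:

* `edir_eq_omg_zpow_turn_mul` — one step in the coordinate model `HV`: leaving `v` towards `w ≠ u`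
  after arriving from `u`, the dart direction is multiplied by `ω^{turn u v w}` (`ω = e^{iπ/3}`);
* `edir_last_eq_omg_zpow_pturn_mul` — along a chain `x :: y :: M` without backtracking the last dart
  direction is `ω^{pturn}` times the first;
* **`hexCenter_sub_eq_exp_winding_mul`** — for a walk `γ` of a domain `Λ` from the door `{p,q}`
  (`p ∉ Λ`) ending at the vertex `t` of the mid-edge `{t,y}`:
  `c(y) − c(t) = e^{i·W(γ)} · (c(q) − c(p))` (chart to `HV`, `HexMidEdgeSAW.winding_eq_pturn_code`,
  and the chain lemma).
-/

noncomputable section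

open scoped Classical
open Literature.Probability.LatticeModels Literature.Probability.RandomPlanarGeometry.SAW
open Literature.Probability.RandomPlanarGeometry.SAW.HV

namespace Summit.CriticalPhenomena.SAWScalingLimit.Theorems.SAWDevelopingMapNoFoldBound.Peel

/-! ### One step in the coordinate model -/

/-- `ω⁻¹ = -ω²` (`ω³ = -1`). -/
theorem omg_zpow_neg_one : omg ^ (-1 : ℤ) = -omg ^ 2 := by
  have h3 := omg_pow_three
  have h : omg * (-omg ^ 2) = 1 := by linear_combination -h3
  rw [zpow_neg_one]
  exact (eq_inv_of_mul_eq_one_right h).symm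

/-- **One step.** Arriving at `v` from `u` and leaving towards a neighbour `w ≠ u`, the direction
of the dart is multiplied by `ω^{turn u v w}`: a left turn (`+1`) rotates by `+π/3`, a right turn
(`-1`) by `-π/3`. -/
theorem edir_eq_omg_zpow_turn_mul {u v w : HV} (hu : hvGraph.Adj v u) (hw : hvGraph.Adj v w)
    (huw : w ≠ u) : edir v w = omg ^ (turn u v w) * edir u v := by
  rcases adj_cases hu hw with rfl | rfl | rfl
  · exact absurd rfl huw
  · -- counterclockwise successor: right turn
    rw [turn_ccw hu, omg_zpow_neg_one, edir, pos_ccw hu, emb_rot2, ← edir, edir_rev v u]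
    ring
  · -- clockwise successor: left turn
    rw [turn_cw hu, zpow_one, edir, pos_cw hu, emb_rot4, ← edir, edir_rev v u]
    ring

/-! ### Along a chain without backtracking -/

/-- **Along a chain.** For a chain `x :: y :: M` of `hvGraph` without backtracking (no vertex equals
the one two places later), the last dart direction is the first one rotated by the total turning:
`edir (last but one) (last) = ω^{pturn} · edir x y`. -/
theorem edir_last_eq_omg_zpow_pturn_mul : ∀ (M : List HV) (x y : HV),
    (x :: y :: M).IsChain hvGraph.Adj →
    (∀ (i : ℕ) (hi : i + 2 < (x :: y :: M).length), (x :: y :: M)[i] ≠ (x :: y :: M)[i + 2]) →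
    edir ((x :: y :: M).dropLast.getLast (by simp)) ((x :: y :: M).getLast (by simp)) =
      omg ^ (pturn (x :: y :: M)) * edir x y
  | [], x, y, _, _ => by simp
  | z :: M, x, y, hch, hnb => by
    have hxy : hvGraph.Adj x y := (List.isChain_cons_cons.1 hch).1
    have hch' : (y :: z :: M).IsChain hvGraph.Adj := (List.isChain_cons_cons.1 hch).2
    have hyz : hvGraph.Adj y z := (List.isChain_cons_cons.1 hch').1
    have hzx : z ≠ x := fun e => hnb 0 (by simp) (by simp [e])
    have ih := edir_last_eq_omg_zpow_pturn_mul M y z hch' (fun i hi => by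
      have := hnb (i + 1) (by simpa using hi)
      simpa using this)
    have e1 : (x :: y :: z :: M).getLast (by simp) = (y :: z :: M).getLast (by simp) :=
      List.getLast_cons _
    have e2 : (x :: y :: z :: M).dropLast.getLast (by simp) = (y :: z :: M).dropLast.getLast (by simp) := by
      simp only [List.dropLast_cons_cons]
      exact List.getLast_cons _
    rw [e1, e2, ih, pturn_cons₃, zpow_add₀ omg_ne_zero, edir_eq_omg_zpow_turn_mul hxy.symm hyz hzx]
    ring

/-! ### Walks between mid-edges -/

/-- **The exit direction of a walk is its entrance direction turned by the winding.** For a walk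
`γ` of `Λ` from the door `{p, q}` (`p ∉ Λ`, so `γ` starts at `q`) to the mid-edge `{t, y}`, ending
at `t` (`t ∼ y`): `c(y) − c(t) = e^{iW(γ)} (c(q) − c(p))`. -/
theorem hexCenter_sub_eq_exp_winding_mul : ∀ {Λ : Finset HexVertex} {p q t y : HexVertex} (γ : HexMidEdgeSAW Λ s(p, q) s(t, y)), p ∉ Λ → hexGraph.Adj p q → hexGraph.Adj t y → ∀ hne : γ.verts ≠ [], γ.verts.getLast hne = t → hexCenter y - hexCenter t = Complex.exp ((γ.winding : ℂ) * Complex.I) * (hexCenter q - hexCenter p) := by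
  intro Λ p q t y γ hp hpq hty hne hlast
  obtain ⟨Φ, α, β, hα, hΦp, hΦq, haff⟩ := exists_chart hpq
  -- the winding is `(π/3) · pturn` of the code `Φ p :: verts.map Φ ++ [Φ y]`
  have hW := γ.winding_eq_pturn_code (e := y) rfl hp hΦp hΦq hty haff hα hne (Or.inl ⟨hlast, rfl⟩)
  have hhead : γ.verts.head hne = q := γ.head_eq rfl hp hne
  obtain ⟨l, hl⟩ : ∃ l, γ.verts = q :: l := by
    obtain ⟨x, l, hx⟩ := List.exists_cons_of_ne_nil hne
    have : x = q := by rw [← hhead]; simp [hx]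
    exact ⟨l, this ▸ hx⟩
  -- the code as `x :: y :: M`
  set M : List HV := l.map Φ ++ [Φ y] with hM
  have hcode : wOut :: (γ.verts.map Φ ++ [Φ y]) = Φ p :: Φ q :: M := by
    rw [hΦp, hl]; simp [hM]
  rw [hcode] at hW
  -- chain
  have hchain : (Φ p :: Φ q :: M).IsChain hvGraph.Adj := by
    have h1 : (p :: (γ.verts ++ [y])).IsChain hexGraph.Adj := by
      rw [hl, List.cons_append, List.isChain_cons_cons]
      refine ⟨hpq, ?_⟩
      rw [← List.cons_append, ← hl, List.isChain_append]
      refine ⟨γ.isChain, List.isChain_singleton _, fun a ha b hb => ?_⟩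
      rw [List.getLast?_eq_some_getLast hne, Option.mem_def, Option.some.injEq] at ha
      simp only [List.head?_cons, Option.mem_def, Option.some.injEq] at hb
      rw [← ha, ← hb, hlast]; exact hty
    have e : Φ p :: Φ q :: M = (p :: (γ.verts ++ [y])).map Φ := by rw [hl]; simp [hM]
    rw [e, List.isChain_map]
    exact h1.imp fun a b h => (Φ.map_rel_iff).2 h
  -- no backtracking
  have hnd : (p :: γ.verts).Nodup := List.nodup_cons.2 ⟨fun h => hp (γ.subset p h), γ.nodup⟩
  have hed := γ.edges_nodup hne
  have hnb0 : ∀ (i : ℕ) (hi : i + 2 < ((p :: γ.verts) ++ [y]).length),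
      ((p :: γ.verts) ++ [y])[i] ≠ ((p :: γ.verts) ++ [y])[i + 2] := by
    intro i hi h'
    have hi' : i + 2 < γ.verts.length + 2 := by have := hi; simp at this; omega
    by_cases h2 : i + 2 < (p :: γ.verts).length
    · rw [List.getElem_append_left (by simp at h2 ⊢; omega), List.getElem_append_left h2] at h'
      have := (hnd.getElem_inj_iff).1 h'
      omega
    · -- `i + 2` is the index of `y`
      have hi2 : i + 2 = γ.verts.length + 1 := by simp at h2; omega
      rw [List.getElem_append_left (by simp; omega), List.getElem_append_right (by simp; omega)] at h'
      simp only [List.length_cons, List.getElem_singleton] at h'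
      cases i with
      | zero =>
        -- `verts = [q]` and `p = y`: the door `{p,q}` and the exit `{t,y} = {q,p}` coincide
        simp only [List.getElem_cons_zero] at h'
        have hlq : l = [] := by
          have : γ.verts.length = 1 := by omega
          rw [hl] at this; simpa using this
        have hqt : q = t := by rw [← hlast]; simp [hl, hlq]
        rw [hl, hlq] at hed
        have : s(p, q) ≠ s(t, y) := by
          intro hh; simp [hh] at hed
        exact this (by rw [← h', hqt, Sym2.eq_swap])
      | succ i =>
        simp only [List.getElem_cons_succ] at h'
        -- `verts[i] = y` and `verts[i+1] = t` (the last vertex): the edge `{y,t}` would be used twice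
        have hlt : γ.verts[i + 1]'(by omega) = t := by
          have : γ.verts[i + 1]'(by omega) = γ.verts.getLast hne := by
            rw [List.getLast_eq_getElem]; congr 1; omega
          exact this.trans hlast
        have hmem : s(y, t) ∈ List.zipWith (fun u w => s(u, w)) γ.verts γ.verts.tail := by
          rw [mem_edges_iff]
          exact ⟨i, by omega, by rw [h', hlt]⟩
        have h2' : (List.zipWith (fun u w => s(u, w)) γ.verts γ.verts.tail ++ [s(t, y)]).Nodup :=
          (List.nodup_cons.1 hed).2
        rw [List.nodup_append] at h2'
        exact h2'.2.2 _ hmem _ (List.mem_singleton_self _) Sym2.eq_swap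
  have hnb : ∀ (i : ℕ) (hi : i + 2 < (Φ p :: Φ q :: M).length),
      (Φ p :: Φ q :: M)[i] ≠ (Φ p :: Φ q :: M)[i + 2] := by
    have e : Φ p :: Φ q :: M = ((p :: γ.verts) ++ [y]).map Φ := by rw [hl]; simp [hM]
    intro i hi h
    have h1 := List.getElem_of_eq e (show i < (Φ p :: Φ q :: M).length by omega)
    have h2 := List.getElem_of_eq e hi
    rw [h1, h2] at h
    simp only [List.getElem_map] at h
    exact hnb0 i (by simpa [e] using hi) (Φ.injective h)
  -- the chain lemma on the code
  have key := edir_last_eq_omg_zpow_pturn_mul M (Φ p) (Φ q) hchain hnb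
  -- identify the last dart of the code: `Φ t → Φ y`
  have elast : (Φ p :: Φ q :: M).getLast (by simp) = Φ y := by simp [hM]
  have cg : ∀ (L₁ L₂ : List HV) (h₁ : L₁ ≠ []) (h₂ : L₂ ≠ []), L₁ = L₂ → L₁.getLast h₁ = L₂.getLast h₂ := by
    rintro L₁ L₂ h₁ h₂ rfl; rfl
  have cg' : ∀ (L₁ L₂ : List HexVertex) (h₁ : L₁ ≠ []) (h₂ : L₂ ≠ []), L₁ = L₂ →
      L₁.getLast h₁ = L₂.getLast h₂ := by
    rintro L₁ L₂ h₁ h₂ rfl; rfl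
  have eprev : (Φ p :: Φ q :: M).dropLast.getLast (by simp) = Φ t := by
    have e1 : (Φ p :: Φ q :: M).dropLast = (p :: γ.verts).map Φ := by
      rw [hl]
      simp only [hM, List.map_cons]
      rw [List.dropLast_cons_of_ne_nil (by simp), List.dropLast_cons_of_ne_nil (by simp),
        List.dropLast_append_of_ne_nil (by simp)]
      simp
    rw [cg _ ((p :: γ.verts).map Φ) _ (by simp) e1, List.getLast_map]
    congr 1
    rw [List.getLast_cons hne, hlast]
  rw [elast, eprev] at key
  -- translate directions back to the honeycomb plane
  have hdir : ∀ a b : HexVertex, edir (Φ a) (Φ b) = α * (hexCenter b - hexCenter a) := by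
    intro a b; rw [edir, emb_sub, haff, haff]; ring
  rw [hdir, hdir] at key
  have hexp : omg ^ (pturn (Φ p :: Φ q :: M)) = Complex.exp ((γ.winding : ℂ) * Complex.I) := by
    rw [hW, omg, ← Complex.exp_int_mul]
    congr 1
    push_cast
    ring
  rw [hexp] at key
  have key' : α * (hexCenter y - hexCenter t) =
      α * (Complex.exp ((γ.winding : ℂ) * Complex.I) * (hexCenter q - hexCenter p)) := by
    rw [key]; ring
  exact mul_left_cancel₀ hα key'

end Summit.CriticalPhenomena.SAWScalingLimit.Theorems.SAWDevelopingMapNoFoldBound.Peel
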